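import Literature.NumberTheory.FaltingsSerre.CoreCertificateTransfer
import Literature.NumberTheory.FaltingsSerre.ConjCertificateRoutes
import HarnessLib

/-!
# The core certificate SPLIT along the cell's sub-certificates: the Galois half `(ρ̄_A, S, T)` and
# the pair datum `(ρ_A, ρ_f)`; transfer of the Galois half to a second surface with conjugate `ρ̄`

[BPPTVY] = A. Brumer, A. Pacetti, C. Poor, G. Tornaría, J. Voight, D. S. Yuen, *On the paramodularity of
typical abelian surfaces*, Algebra & Number Theory **13**:5 (2019) 1145–1195 [cite: BrumerEtAl2019]
(PRINTED numbering and pages).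

**Printed.** [Alg 2.4.1 p. 1156] takes as input `ρ₁, ρ₂ : Gal_{F,S} → G(ℤ_ℓ)` with absolutely
irreducible, EQUAL reductions `ρ̄` and runs: "1. Apply Algorithm 2.2.3 … 2. Using computational class
field theory, enumerate all `ℓ`-elementary abelian extensions `L ⊇ K` unramified away from `S` … 3. …
find all obstructing pairs `(L, φ)` extending `(K, ρ̄)` … 4. For each such pair `(L, φ)`, find a prime
`𝔭 ∉ S` such that `utr φ(Frob_𝔭) ≢ 0 (mod ℓ)` … 5. check that `tr ρ₁(Frob_𝔭) ≡ tr ρ₂(Frob_𝔭)` …".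
Steps 2–4 depend ONLY on `(K, ρ̄, S)` — i.e. on the residual representation of ONE side and the
ramification set — and absolute irreducibility is a property of `ρ̄` [Lemma 5.1.7 p. 1173, Lemma 5.2.1
p. 1174].  [§7.3 p. 1191, Thm 7.3.1] treats the surface `A₅₈₇ = Jac(y² + (x³+x+1)y = −x²−x)` with
`f⁻₅₈₇` (image `S₆`, `P(587) = {3,5,7,11,13,17,19,23,29,37,41}`); a second surface of the same
conductor with the SAME `2`-division field (the cell's pair `(A⁺, f⁺₅₈₇)`, LMFDB class `587.a`, not in
the paper) has a residual representation CONJUGATE to `ρ̄_{A₅₈₇}` inside `ι(S₆) = Sp₄(𝔽₂)`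
[(5.1.1)–(5.1.2) p. 1173] once one Frobenius datum excludes the outer automorphism of `S₆`
[(5.1.8) p. 1174] (`ResidualRigidity.lean`, `exists_conj_of_ker_iff_of_trace_orderThree`).

**What this file types (schematic choice D-27 of the cell's DIVERGENCE.md; no new cited fact).**  The
five-field `CoreCertificate N T ν ρA ρf` (`CoreCertificate.lean`, D-25) is the conjunction of
* `GaloisCertificate N T ν ρA` — the blocks computed from the CURVE ALONE: `similitude` of `ρA`
  [(4.1.3) p. 1163], `absIrreducible` and `complete` (Steps 2–4 for `ρ̄A`, `S` = places over `2N`,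
  `P` = places over `T`) — in the cell's pipeline exactly the engineer-1 "Galois half"
  `certs/<N>/galois/galois_certificate.canonical.json` (blocks `classfield`, `group_theory`,
  `obstructing`, `residual.image`), which has its own hash and its own referee audit; and
* `PairCertificate ν ρA ρf` — the blocks about the PAIR: `similitude₁`, `similitude₂` [(4.1.3);
  Thm 4.3.4 (ii) p. 1169] and Step 1 up to frame, `∃ π ∈ S₆, ρ̄f = ι(π) ρ̄A ι(π)⁻¹` (blocks
  `similitude`, `residual` of the merged certificate).
`coreCertificate_iff : CoreCertificate N T ν ρA ρf ↔ GaloisCertificate N T ν ρA ∧ PairCertificate ν ρA ρf`.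
The point of the split: the Galois half TRANSFERS to any `ρA'` with `ρ̄_{A'} = ι(π) ρ̄_A ι(π)⁻¹`
(`GaloisCertificate.ofResidualConj`; `IsAbsIrreducible.of_conj`, `complete_of_conj` of
`CertificateConjTransfer.lean`), so a second surface of the same level needs only ITS pair datum and
its Euler/trace data: `paramodular_of_galoisCertificate_transfer` (conjugacy `π` given) and, for image
`S₆`, `paramodular_of_galoisCertificate_S6` in which `π` is PRODUCED in the kernel from `#im ρ̄_A = 720`,
the same kernel field, and the Euler factors of the two surfaces at ONE good odd prime `q` with `a_q`
even and `b_q` odd on both sides (`exists_residual_conj_of_eulerData`, `CoreCertificateTransfer.lean`).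
For image `S₆` absolute irreducibility is moreover a THEOREM (`isAbsIrreducible_of_range_eq_iotaGL`,
from `GSp4F2AbsIrreducible.isAbsIrreducible_of_S6`), whence the constructor
`GaloisCertificate.of_card_eq`.  The older one-hash route (`paramodular_of_coreCertificate`,
`paramodular_of_coreCertificate_transfer` with a full core certificate of the first pair) is recovered
by `CoreCertificate.toGaloisCertificate`.  Instance: `Paramodular587plusCore.lean`.

## References
* [BPPTVY] Alg 2.4.1 p. 1156; Thm 2.1.5 p. 1150; §2.3 p. 1149; (4.1.3)–(4.1.5) pp. 1163–1164;
  Thm 4.3.4 p. 1169; Lemma 5.1.7 p. 1173; (5.1.1)–(5.1.2) p. 1173; (5.1.8) p. 1174; Lemma 5.2.1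
  p. 1174; Thm 7.1.3 p. 1187; Thm 7.3.1 p. 1191. [cite: BrumerEtAl2019]
-/

noncomputable section

namespace Literature.NumberTheory.FaltingsSerre

open Matrix Equiv Field IsDedekindDomain Polynomial
open Literature.NumberTheory.GaloisRepresentations Literature.NumberTheory.FaltingsSerre.GSp4F2
  Literature.NumberTheory.Automorphic.Paramodular Literature.NumberTheory.Automorphic
  Literature.AlgebraicGeometry.Motives
open scoped NumberField

/-! ## Image `S₆` ⇒ absolutely irreducible -/

/-- **A residual representation ONTO `ι(S₆) = Sp₄(𝔽₂)` is absolutely irreducible** (the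
`4`-dimensional representation `Z = U⁰/L` of `S₆` over `𝔽₂`; the generators `(1 2 3 4 5 6)`, `(1 6)`
lie in the image). [cite: BrumerEtAl2019, Lemma 5.1.7 p. 1173; (5.1.1)–(5.1.2) p. 1173] -/
theorem isAbsIrreducible_of_range_eq_iotaGL {Γ : Type*} [Group Γ] (σ : Γ →* GL (Fin 4) (ZMod 2))
    (h : σ.range = iotaGL.range) : IsAbsIrreducible σ :=
  isAbsIrreducible_of_S6 σ 1 (by rw [one_mul, inv_one, mul_one, h]; exact ⟨c12345, rfl⟩)
    (by rw [one_mul, inv_one, mul_one, h]; exact ⟨t16, rfl⟩)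

/-! ## The two halves of a core certificate -/

section Split

variable {N : ℕ} {T : Finset ℕ} {ν ν' : absoluteGaloisGroup ℚ → ℤ_[2]}
  {ρA ρf ρA' ρf' : FramedGaloisRep ℚ ℤ_[2] 4}

variable (N T ν ρA) in
/-- **The Galois half of a certificate** (level `N`, check primes `T`, `K = ℚ`, `ℓ = 2`, `G = GSp₄`,
`J = antiIdAlt4 ℤ_[2]`): the blocks of `CoreCertificate N T ν ρA ρf` that concern `ρA` ALONE —
* `similitude` — `ρA(σ)ᵀ J ρA(σ) = ν(σ) J` [BPPTVY, (4.1.3) p. 1163: "`ρ_{A,ℓ} : Gal_{ℚ,S} → GSp₄(ℤ_ℓ)`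
  … with similitude character `χ_ℓ`"];
* `absIrreducible` — `ρ̄A` absolutely irreducible [Lemma 5.1.7 p. 1173; Lemma 5.2.1 p. 1174];
* `complete` — Steps 2–4 of [Alg 2.4.1 p. 1156] for `(ℚ(ρ̄A), ρ̄A, S)`: the Frobenii at the places
  over `T` detect every locally constant `𝔰𝔭`-valued obstructing deviation cocycle of `ρ̄A`
  unramified outside `2N` [Remark 2.4.2; Thms 5.3.1, 5.3.3 p. 1176].
In the cell's pipeline: the engineer-1 sub-certificate `certs/<N>/galois` (blocks `classfield`,
`group_theory`, `obstructing`, `residual.image`), attested by hash; never a Literature fact.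
[cite: BrumerEtAl2019, Alg 2.4.1 p. 1156; (4.1.3) p. 1163; Lemma 5.1.7 p. 1173] -/
structure GaloisCertificate : Prop where
  /-- `ρA(σ)ᵀ J ρA(σ) = ν(σ) J`, `J = antiIdAlt4 ℤ_[2]`. -/
  similitude : ∀ σ, IsSimilitude (antiIdAlt4 ℤ_[2]) (ν σ)
    ((ρA σ : GL (Fin 4) ℤ_[2]) : Matrix (Fin 4) (Fin 4) ℤ_[2])
  /-- `ρ̄A` is absolutely irreducible. -/
  absIrreducible : IsAbsIrreducible (residual ρA.toMonoidHom)
  /-- Steps 2–4 for `ρ̄A` with `S` = places over `2N`, `P` = places over `T`. -/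
  complete : ∀ μ : absoluteGaloisGroup ℚ → Matrix (Fin 4) (Fin 4) (ZMod 2), IsLocallyConstant μ →
    (∀ σ ∈ inertiaOutside ℚ (placesOver (badPrimes N)), μ σ = 0) →
    ValuedIn (spLie ((antiIdAlt4 ℤ_[2]).map (PadicInt.toZMod (p := 2)))) μ →
    IsDeviationCocycle (residual ρA.toMonoidHom) μ → IsObstructing (residual ρA.toMonoidHom) μ →
    ∃ σ ∈ frobeniusAt ℚ (placesOver T), IsObstructingElt (residual ρA.toMonoidHom) μ σ

variable (ν ρA ρf) in
/-- **The pair datum of a certificate**: the blocks of `CoreCertificate N T ν ρA ρf` about the PAIR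
`(ρA, ρf)` — the two similitude identities with the common multiplier `ν` [BPPTVY, (4.1.3) p. 1163;
Thm 4.3.4 (ii) p. 1169] and Step 1 up to frame, `ρ̄f = ι(π) ρ̄A ι(π)⁻¹` for some `π ∈ S₆` [§2.3
p. 1149; Alg 2.2.3 p. 1151] (JSON blocks `similitude`, `residual`).  Independent of `N` and `T`.
[cite: BrumerEtAl2019, Alg 2.4.1 Step 1 p. 1156; §2.3 p. 1149; Thm 4.3.4 p. 1169] -/
structure PairCertificate : Prop where
  /-- `ρA(σ)ᵀ J ρA(σ) = ν(σ) J`. -/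
  similitude₁ : ∀ σ, IsSimilitude (antiIdAlt4 ℤ_[2]) (ν σ)
    ((ρA σ : GL (Fin 4) ℤ_[2]) : Matrix (Fin 4) (Fin 4) ℤ_[2])
  /-- `ρf(σ)ᵀ J ρf(σ) = ν(σ) J` (same `ν`). -/
  similitude₂ : ∀ σ, IsSimilitude (antiIdAlt4 ℤ_[2]) (ν σ)
    ((ρf σ : GL (Fin 4) ℤ_[2]) : Matrix (Fin 4) (Fin 4) ℤ_[2])
  /-- Step 1 up to frame: `ρ̄f = ι(π) ρ̄A ι(π)⁻¹` for some `π ∈ S₆`. -/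
  residual_conj : ∃ π : Perm (Fin 6), ∀ σ,
    residual ρf.toMonoidHom σ = iotaGL π * residual ρA.toMonoidHom σ * (iotaGL π)⁻¹

/-- A core certificate contains its Galois half. [cite: BrumerEtAl2019, Alg 2.4.1 p. 1156] -/
theorem CoreCertificate.toGaloisCertificate (C : CoreCertificate N T ν ρA ρf) :
    GaloisCertificate N T ν ρA where
  similitude := C.similitude₁
  absIrreducible := C.absIrreducible
  complete := C.complete

/-- A core certificate contains its pair datum. [cite: BrumerEtAl2019, Alg 2.4.1 p. 1156] -/
theorem CoreCertificate.toPairCertificate (C : CoreCertificate N T ν ρA ρf) :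
    PairCertificate ν ρA ρf where
  similitude₁ := C.similitude₁
  similitude₂ := C.similitude₂
  residual_conj := C.residual_conj

/-- **Galois half + pair datum = core certificate.** [cite: BrumerEtAl2019, Alg 2.4.1 p. 1156] -/
theorem CoreCertificate.ofGaloisCertificate (G : GaloisCertificate N T ν ρA)
    (P : PairCertificate ν ρA ρf) : CoreCertificate N T ν ρA ρf where
  similitude₁ := P.similitude₁
  similitude₂ := P.similitude₂
  residual_conj := P.residual_conj
  absIrreducible := G.absIrreducible
  complete := G.complete

variable (N T ν ρA ρf) in
/-- The split is exact: `CoreCertificate ↔ GaloisCertificate ∧ PairCertificate`. [cite: BrumerEtAl2019, Alg 2.4.1 p. 1156] -/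
theorem coreCertificate_iff :
    CoreCertificate N T ν ρA ρf ↔ GaloisCertificate N T ν ρA ∧ PairCertificate ν ρA ρf :=
  ⟨fun C => ⟨C.toGaloisCertificate, C.toPairCertificate⟩,
    fun h => CoreCertificate.ofGaloisCertificate h.1 h.2⟩

/-- **The Galois half for image `S₆` from a COUNT**: if `ρA` is `GSp(J)`-valued (`similitude`) and
`#im ρ̄A = 720` then `im ρ̄A = ι(S₆)` (`GSp4F2.residual_range_eq_iotaGL_of_card`) and `ρ̄A` is
absolutely irreducible — so only `similitude` and Steps 2–4 remain to be supplied (the form in which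
the cell's `587` Galois certificate knows the image: the `2`-division field has Galois group `S₆`).
[cite: BrumerEtAl2019, §5.1 p. 1173, Lemma 5.1.7 p. 1173 and §7.3 p. 1191] -/
theorem GaloisCertificate.of_card_eq
    (hs : ∀ σ, IsSimilitude (antiIdAlt4 ℤ_[2]) (ν σ)
      ((ρA σ : GL (Fin 4) ℤ_[2]) : Matrix (Fin 4) (Fin 4) ℤ_[2]))
    (hcard : Nat.card (residual ρA.toMonoidHom).range = 720)
    (hc : ∀ μ : absoluteGaloisGroup ℚ → Matrix (Fin 4) (Fin 4) (ZMod 2), IsLocallyConstant μ →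
      (∀ σ ∈ inertiaOutside ℚ (placesOver (badPrimes N)), μ σ = 0) →
      ValuedIn (spLie ((antiIdAlt4 ℤ_[2]).map (PadicInt.toZMod (p := 2)))) μ →
      IsDeviationCocycle (residual ρA.toMonoidHom) μ → IsObstructing (residual ρA.toMonoidHom) μ →
      ∃ σ ∈ frobeniusAt ℚ (placesOver T), IsObstructingElt (residual ρA.toMonoidHom) μ σ) :
    GaloisCertificate N T ν ρA where
  similitude := hs
  absIrreducible :=
    isAbsIrreducible_of_range_eq_iotaGL _ (GSp4F2.residual_range_eq_iotaGL_of_card ρA ν hs hcard)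
  complete := hc

/-- **Transfer of the Galois half along a residual conjugacy inside `ι(S₆)`.**  If `G` is a Galois
certificate for `ρA` (level `N`, check primes `T`), `ρ̄_{A'} = ι(π) ρ̄_A ι(π)⁻¹` for some `π ∈ S₆`, and
`ρA'` is `GSp(J)`-valued with multiplier `ν'`, then `G` is a Galois certificate for `ρA'` with the SAME
`N`, `T`: `absIrreducible` by `IsAbsIrreducible.of_conj`, `complete` by `complete_of_conj` (`ι(π)` is
symplectic for `J̄ = J mod 2 = antiId4 𝔽₂`: `antiIdAlt4_map_toZMod`, `GSp4F2.mem_range_iotaGL`) —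
Steps 2–4 see only `(ℚ(ρ̄), ρ̄, S)`. [cite: BrumerEtAl2019, Alg 2.4.1 Steps 2–4 p. 1156; (5.1.1)–(5.1.2) p. 1173] -/
theorem GaloisCertificate.ofResidualConj (G : GaloisCertificate N T ν ρA) (π : Perm (Fin 6))
    (h₁ : ∀ σ, residual ρA'.toMonoidHom σ =
      iotaGL π * residual ρA.toMonoidHom σ * (iotaGL π)⁻¹)
    (hs : ∀ σ, IsSimilitude (antiIdAlt4 ℤ_[2]) (ν' σ)
      ((ρA' σ : GL (Fin 4) ℤ_[2]) : Matrix (Fin 4) (Fin 4) ℤ_[2])) :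
    GaloisCertificate N T ν' ρA' where
  similitude := hs
  absIrreducible := IsAbsIrreducible.of_conj _ _ (iotaGL π) h₁ G.absIrreducible
  complete := by
    have hg : ((iotaGL π : GL (Fin 4) (ZMod 2)) : Matrix (Fin 4) (Fin 4) (ZMod 2))ᵀ *
        (antiIdAlt4 ℤ_[2]).map (PadicInt.toZMod (p := 2)) * (iotaGL π : GL (Fin 4) (ZMod 2)) =
        (antiIdAlt4 ℤ_[2]).map (PadicInt.toZMod (p := 2)) := by
      rw [antiIdAlt4_map_toZMod]
      exact (mem_range_iotaGL _).1 ⟨π, rfl⟩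
    exact complete_of_conj _ _ _ (iotaGL π) hg h₁ _ _ G.complete

/-- The D-26 transfer recovered: a full core certificate of `(ρA, ρf)` and a pair datum for
`(ρA', ρf')` with `ρ̄_{A'} = ι(π) ρ̄_A ι(π)⁻¹` give a core certificate of `(ρA', ρf')`; this is
`CoreCertificate.ofResidualConj` factored through the Galois half. [cite: BrumerEtAl2019, Alg 2.4.1 p. 1156] -/
theorem CoreCertificate.ofGaloisCertificate_ofResidualConj (G : GaloisCertificate N T ν ρA)
    (π : Perm (Fin 6))
    (h₁ : ∀ σ, residual ρA'.toMonoidHom σ =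
      iotaGL π * residual ρA.toMonoidHom σ * (iotaGL π)⁻¹)
    (P' : PairCertificate ν' ρA' ρf') : CoreCertificate N T ν' ρA' ρf' :=
  CoreCertificate.ofGaloisCertificate (G.ofResidualConj π h₁ P'.similitude₁) P'

end Split

/-! ## Instance templates over the split -/

section Templates

variable {N : ℕ} {T : Finset ℕ} {ν ν' : absoluteGaloisGroup ℚ → ℤ_[2]}
  {ρA ρf ρA' ρf' : FramedGaloisRep ℚ ℤ_[2] 4}
  {A A' : AbelianVariety ℚ} {b : Module.Basis (Fin 4) ℚ_[2] (A.rationalTateModule 2)}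
  {b' : Module.Basis (Fin 4) ℚ_[2] (A'.rationalTateModule 2)}
  {f f' : Matrix (Fin 2) (Fin 2) ℂ → ℂ}

/-- **`A` is paramodular of level `N` away from `N`, from the Galois half and the pair datum** — the
instance template `paramodular_of_coreCertificate` (`CoreCertificate.lean`) with its certificate
hypothesis split in two (two hashes in the cell's pipeline: `certs/<N>/galois` and the merged
certificate's `similitude`/`residual` blocks).  All other binders verbatim: `hframe` [(4.1.3)], Euler
data `aA bA af bf` with `hA` [(4.1.4)–(4.1.5)] and `hfe` [(4.2.18)], `hρf_unr` [Thm 4.3.4 (iii)],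
`hρf` [Thm 4.3.4 (iv)], `hT` (check primes are good odd primes), the Step-5 trace table `h5`, the form
`hcusp`, `hne`, and the hand check `h2` at `p = 2`.  The criterion [Thm 2.1.5] is the tree theorem
`traceEq_of_faltingsSerre_symplectic_holds`, consumed inside. [cite: BrumerEtAl2019, Thm 7.1.3 p. 1187; Thm 2.1.5 p. 1150; Alg 2.4.1 p. 1156; Thm 4.3.4 p. 1169] -/
theorem paramodular_of_galoisCertificate [NeZero N] (G : GaloisCertificate N T ν ρA)
    (P : PairCertificate ν ρA ρf)
    (hframe : A.IsFrameOfTateRep 2 b (rationalize ρA)) (aA bA af bf : ℕ → ℤ)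
    (hA : ∀ p : ℕ, p.Prime → ¬ p ∣ N →
      A.HasGoodEulerFactorAt p ((lPolynomialOfSurface p (aA p) (bA p)).map (Int.castRingHom ℚ)))
    (hρf_unr : ∀ v ∉ placesOver (badPrimes N), ρf.IsUnramifiedAt v)
    (hρf : ∀ p : ℕ, p.Prime → ¬ p ∣ N → p ≠ 2 →
      ∀ v : HeightOneSpectrum (𝓞 ℚ), ((p : ℕ) : 𝓞 ℚ) ∈ v.asIdeal →
        ρf.HasFrobCharpolyAt v
          ((lPolynomialOfSurface p (af p) (bf p)).reverse.map (Int.castRingHom ℤ_[2])))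
    (hT : ∀ p ∈ T, p.Prime ∧ ¬ p ∣ N ∧ p ≠ 2) (h5 : ∀ p ∈ T, aA p = af p)
    (hcusp : IsParamodularCuspForm N 2 f) (hne : ∃ Z ∈ siegelUpperHalfSpace 2, f Z ≠ 0)
    (hfe : ∀ p : ℕ, p.Prime → ¬ p ∣ N →
      HasSpinorEulerFactorAt 2 p f ((lPolynomialOfSurface p (af p) (bf p)).map (Int.castRingHom ℂ)))
    (h2 : ¬ 2 ∣ N → aA 2 = af 2 ∧ bA 2 = bf 2) :
    IsParamodularAwayFrom A N f :=
  paramodular_of_coreCertificate (CoreCertificate.ofGaloisCertificate G P) hframe aA bA af bf hA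
    hρf_unr hρf hT h5 hcusp hne hfe h2

/-- **A SECOND surface `A'` of level `N`, from the Galois half of the FIRST and a residual conjugacy**:
`ρ̄_{A'} = ι(π) ρ̄_A ι(π)⁻¹` (`π`, `h₁` — e.g. from `ResidualRigidity.lean`), the pair datum `P'` of
`(ρA', ρf')`, and the data binders of `(A', f')` as in `paramodular_of_galoisCertificate`.  Steps 2–4
are NOT recomputed for `A'`. [cite: BrumerEtAl2019, Alg 2.4.1 p. 1156; Thm 7.3.1 p. 1191; Thm 2.1.5 p. 1150; Thm 4.3.4 p. 1169] -/
theorem paramodular_of_galoisCertificate_transfer [NeZero N] (G : GaloisCertificate N T ν ρA)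
    (π : Perm (Fin 6))
    (h₁ : ∀ σ, residual ρA'.toMonoidHom σ =
      iotaGL π * residual ρA.toMonoidHom σ * (iotaGL π)⁻¹)
    (P' : PairCertificate ν' ρA' ρf')
    (hframe' : A'.IsFrameOfTateRep 2 b' (rationalize ρA')) (aA' bA' af' bf' : ℕ → ℤ)
    (hA' : ∀ p : ℕ, p.Prime → ¬ p ∣ N →
      A'.HasGoodEulerFactorAt p ((lPolynomialOfSurface p (aA' p) (bA' p)).map (Int.castRingHom ℚ)))
    (hρf'_unr : ∀ v ∉ placesOver (badPrimes N), ρf'.IsUnramifiedAt v)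
    (hρf' : ∀ p : ℕ, p.Prime → ¬ p ∣ N → p ≠ 2 →
      ∀ v : HeightOneSpectrum (𝓞 ℚ), ((p : ℕ) : 𝓞 ℚ) ∈ v.asIdeal →
        ρf'.HasFrobCharpolyAt v
          ((lPolynomialOfSurface p (af' p) (bf' p)).reverse.map (Int.castRingHom ℤ_[2])))
    (hT : ∀ p ∈ T, p.Prime ∧ ¬ p ∣ N ∧ p ≠ 2) (h5' : ∀ p ∈ T, aA' p = af' p)
    (hcusp' : IsParamodularCuspForm N 2 f') (hne' : ∃ Z ∈ siegelUpperHalfSpace 2, f' Z ≠ 0)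
    (hfe' : ∀ p : ℕ, p.Prime → ¬ p ∣ N →
      HasSpinorEulerFactorAt 2 p f' ((lPolynomialOfSurface p (af' p) (bf' p)).map (Int.castRingHom ℂ)))
    (h2' : ¬ 2 ∣ N → aA' 2 = af' 2 ∧ bA' 2 = bf' 2) :
    IsParamodularAwayFrom A' N f' :=
  paramodular_of_galoisCertificate (G.ofResidualConj π h₁ P'.similitude₁) P' hframe' aA' bA' af' bf'
    hA' hρf'_unr hρf' hT h5' hcusp' hne' hfe' h2'

/-- **Image `S₆`: the second surface from the Galois half of the first, the conjugating `π` PRODUCED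
in the kernel.**  Inputs about `ρ̄_A`, `ρ̄_{A'}`: the Galois half `G` of `ρA`; `hcard : #im ρ̄_A = 720`
(the `2`-division field of `A` has Galois group `S₆`; ⇒ `im ρ̄_A = ι(S₆)`,
`GSp4F2.residual_range_eq_iotaGL_of_card`); `hker` (the two `2`-division fields coincide:
`ker ρ̄_A = ker ρ̄_{A'}`); and the Euler factors of `A` and `A'` at ONE good odd prime `q` (`hAq`, `hA'q`,
in surface shape) with `a_q` even and `b_q` odd on both sides (`hq₃`) — then some Frobenius `u` at `q`
has `ρ̄_A(u)` of order `3` with equal traces under `ρ̄_A`, `ρ̄_{A'}` [(5.1.8) p. 1174], which kills the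
outer automorphism of `S₆`, and `exists_residual_conj_of_eulerData` (`CoreCertificateTransfer.lean`)
produces `π`.  Then the pair datum `P'` and the data binders of `(A', f')`.  (For `N = 587`: `q = 3`,
`L₃(A₅₈₇) = 1 + 4T + 9T² + 12T³ + 9T⁴`, `L₃(A⁺) = 1 + T² + 9T⁴`.) [cite: BrumerEtAl2019, (5.1.8) p. 1174; (5.2.3) p. 1175; Thm 7.3.1 p. 1191; Alg 2.4.1 p. 1156; Thm 4.3.4 p. 1169] -/
theorem paramodular_of_galoisCertificate_S6 [NeZero N] (G : GaloisCertificate N T ν ρA)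
    (hcard : Nat.card (residual ρA.toMonoidHom).range = 720)
    (hframe : A.IsFrameOfTateRep 2 b (rationalize ρA))
    (hker : ∀ γ, residual ρA.toMonoidHom γ = 1 ↔ residual ρA'.toMonoidHom γ = 1)
    (P' : PairCertificate ν' ρA' ρf')
    (hframe' : A'.IsFrameOfTateRep 2 b' (rationalize ρA')) {q : ℕ} (hq : q.Prime) (hq2 : q ≠ 2)
    {a c : ℤ} (hAq : A.HasGoodEulerFactorAt q ((lPolynomialOfSurface q a c).map (Int.castRingHom ℚ)))
    (aA' bA' af' bf' : ℕ → ℤ)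
    (hA' : ∀ p : ℕ, p.Prime → ¬ p ∣ N →
      A'.HasGoodEulerFactorAt p ((lPolynomialOfSurface p (aA' p) (bA' p)).map (Int.castRingHom ℚ)))
    (hqN : ¬ q ∣ N) (hq₃ : Even a ∧ Odd c ∧ Even (aA' q) ∧ Odd (bA' q))
    (hρf'_unr : ∀ v ∉ placesOver (badPrimes N), ρf'.IsUnramifiedAt v)
    (hρf' : ∀ p : ℕ, p.Prime → ¬ p ∣ N → p ≠ 2 →
      ∀ v : HeightOneSpectrum (𝓞 ℚ), ((p : ℕ) : 𝓞 ℚ) ∈ v.asIdeal →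
        ρf'.HasFrobCharpolyAt v
          ((lPolynomialOfSurface p (af' p) (bf' p)).reverse.map (Int.castRingHom ℤ_[2])))
    (hT : ∀ p ∈ T, p.Prime ∧ ¬ p ∣ N ∧ p ≠ 2) (h5' : ∀ p ∈ T, aA' p = af' p)
    (hcusp' : IsParamodularCuspForm N 2 f') (hne' : ∃ Z ∈ siegelUpperHalfSpace 2, f' Z ≠ 0)
    (hfe' : ∀ p : ℕ, p.Prime → ¬ p ∣ N →
      HasSpinorEulerFactorAt 2 p f' ((lPolynomialOfSurface p (af' p) (bf' p)).map (Int.castRingHom ℂ)))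
    (h2' : ¬ 2 ∣ N → aA' 2 = af' 2 ∧ bA' 2 = bf' 2) :
    IsParamodularAwayFrom A' N f' := by
  obtain ⟨π, h₁⟩ := exists_residual_conj_of_eulerData
    (GSp4F2.residual_range_eq_iotaGL_of_card ρA ν G.similitude hcard) P'.similitude₁ hker hframe
    hframe' hq hq2 hAq (hA' q hq hqN) hq₃.1 hq₃.2.1 hq₃.2.2.1 hq₃.2.2.2
  exact paramodular_of_galoisCertificate_transfer G π h₁ P' hframe' aA' bA' af' bf' hA' hρf'_unr hρf'
    hT h5' hcusp' hne' hfe' h2'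

end Templates

end Literature.NumberTheory.FaltingsSerre

end
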